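import Summits.NavierStokesRegularity.NavierStokesRegularity.Theorems.AdaptedFrequencyAdaptedFrequencyConvergesStubFrequencyCeiling

/-!
# Frequency floor: the adapted frequency is bounded BELOW near `T`
(crux stmt-NavierStokesRegularity-10493 `AdaptedFrequency.AdaptedFrequencyConverges`; rung of line
`birkhoff-recurrent-hull`, lands `--supports stmt-NavierStokesRegularity-10493`)

Companion of the landed ceiling `UnsteadinessSqueeze.stub_frequencyCeiling` (p96525, `Λ ≤ 2K`):
under the crux hypotheses the adapted frequency `Λ(t) = (T − t) H′(t)/H(t)` of the adapted
enstrophy `H(t) = ∫ ‖curl u(t)‖² G(t)` is bounded below on a final window `[t₁, T)`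
(`frequencyFloor`).  Hence `Λ` is BOUNDED near `T` (`frequency_abs_le`), its `liminf` / `limsup`
at `T⁻` are finite, and the cluster set of `Λ` at `T⁻` is a compact interval (it contains `2`:
`…LimitTwo.mapClusterPt_two`).

Proof.  Keep the dissipation in the first variation
`H′(t) = ∫ (2⟪ω, (∇u)ω⟫ − 2ν|∇ω|²_F) G(t)` (`UnsteadinessSqueeze.frequencyCeiling_hasDerivAt`):
pointwise `2⟪ω, (∇u)ω⟫ − 2ν|∇ω|²_F ≥ −2‖∇u‖ ‖ω‖² − 2ν|∇ω|²_F`, with the Type-I derivative bounds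
`‖∇u(t)‖_∞ ≤ K₁/(T − t)` (`TauberianOmegaLimit.pinchingUpper_fderiv_bound`) and
`‖∇²u(t)‖_∞ ≤ K₂ (T − t)^{−3/2}` (`TauberianOmegaLimit.pinchingUpper_iteratedFDeriv_bound`, so
`|∇ω|²_F ≤ 3‖curlCLM‖² K₂² (T − t)^{−3}` by `norm_fderiv_curl_le`) and `∫ G = 1`:
`H′(t) ≥ −(2K₁/(T − t)) H(t) − 6ν‖curlCLM‖²K₂² (T − t)^{−3}`; dividing by the floor
`H(t) ≥ c₀ (T − t)^{−2}` (`TauberianOmegaLimit.stub_pinchingLower`, p82804 — the far-field input)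
gives `Λ(t) ≥ −2K₁ − 6ν‖curlCLM‖²K₂²/c₀`.  (Where the density is not integrable the Bochner
integral is `0` and the bound holds trivially, exactly as in the ceiling.)
-/

noncomputable section

open scoped Topology InnerProductSpace RealInnerProductSpace
open Literature.Analysis.FluidPDE Set Filter MeasureTheory

set_option linter.dupNamespace false

namespace Summit.NavierStokesRegularity.NavierStokesRegularity.Theorems.AdaptedFrequencyConverges.LimitTwo

open TauberianOmegaLimit UnsteadinessSqueeze

/-- `|B|²_F ≤ 3 ‖B‖²` for a linear map on `ℝ³` (sum over an orthonormal basis of three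
vectors of `‖B eᵢ‖² ≤ ‖B‖²`). -/
theorem frobeniusNormSq_le_three_mul_sq
    (B : EuclideanSpace ℝ (Fin 3) →L[ℝ] EuclideanSpace ℝ (Fin 3)) :
    frobeniusNormSq B ≤ 3 * ‖B‖ ^ 2 := by
  rw [frobeniusNormSq_eq_sum (EuclideanSpace.basisFun (Fin 3) ℝ)]
  calc ∑ i, ‖B ((EuclideanSpace.basisFun (Fin 3) ℝ) i)‖ ^ 2 ≤ ∑ _i : Fin 3, ‖B‖ ^ 2 :=
        Finset.sum_le_sum fun i _ => by
          refine pow_le_pow_left₀ (norm_nonneg _) ?_ 2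
          simpa using B.le_opNorm ((EuclideanSpace.basisFun (Fin 3) ℝ) i)
    _ = 3 * ‖B‖ ^ 2 := by simp

/-- **Pointwise lower bound on the enstrophy density**:
`−2‖A‖ ‖ω‖² − 2ν|B|²_F ≤ 2⟪ω, Aω⟫ − 2ν|B|²_F` (Cauchy–Schwarz and the operator norm). -/
theorem frequencyFloor_density_ge (ν : ℝ) (ω : EuclideanSpace ℝ (Fin 3))
    (A B : EuclideanSpace ℝ (Fin 3) →L[ℝ] EuclideanSpace ℝ (Fin 3)) :
    -(2 * ‖A‖ * ‖ω‖ ^ 2) - 2 * ν * frobeniusNormSq B ≤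
      2 * ⟪ω, A ω⟫ - 2 * ν * frobeniusNormSq B := by
  have h1 : -(‖A‖ * ‖ω‖ ^ 2) ≤ ⟪ω, A ω⟫ := by
    have h := abs_real_inner_le_norm ω (A ω)
    have h' : ‖ω‖ * ‖A ω‖ ≤ ‖A‖ * ‖ω‖ ^ 2 := by
      calc ‖ω‖ * ‖A ω‖ ≤ ‖ω‖ * (‖A‖ * ‖ω‖) :=
            mul_le_mul_of_nonneg_left (A.le_opNorm ω) (norm_nonneg _)
        _ = ‖A‖ * ‖ω‖ ^ 2 := by ring
    have := (abs_le.1 (h.trans h')).1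
    linarith
  linarith

/-- **Squared Type-I Hessian bound.** From `‖∇²u(t, x)‖ ≤ K₂ (T − t)^{−3/2}` on `[T/2, T)`:
`‖∇²u(t, x)‖² (T − t)³ ≤ K₂²`. -/
theorem frequencyFloor_hessian_sq {ν T : ℝ}
    {u : ℝ → EuclideanSpace ℝ (Fin 3) → EuclideanSpace ℝ (Fin 3)}
    {p : ℝ → EuclideanSpace ℝ (Fin 3) → ℝ} (hν : 0 < ν) (hT : 0 < T)
    (hcl : IsClassicalNSSolutionOn (Ico 0 T) ν 0 u p) (hLH : IsLerayHopfOn T ν 0 (u 0) u)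
    (hdec : HasRapidSpatialDecay (u 0)) (hTI : IsTypeIBlowup u T) :
    ∃ K₂ : ℝ, 0 ≤ K₂ ∧ ∀ t ∈ Ico (T / 2) T, ∀ x,
      ‖iteratedFDeriv ℝ 2 (u t) x‖ ^ 2 * (T - t) ^ 3 ≤ K₂ ^ 2 := by
  obtain ⟨K₂, hK₂, h⟩ := pinchingUpper_iteratedFDeriv_bound hν hT hcl hLH hdec hTI 2
  refine ⟨K₂, hK₂, fun t ht x => ?_⟩
  have hs : 0 < T - t := sub_pos.2 ht.2
  have h1 := h t ht x
  -- `(T − t)^{−3/2}`, squared, times `(T − t)³` is `1`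
  have hexp : (-((((2 : ℕ) : ℝ) + 1) / 2)) = -(3 / 2 : ℝ) := by norm_num
  rw [hexp] at h1
  have hsq : ((T - t) ^ (-(3 / 2 : ℝ))) ^ 2 * (T - t) ^ 3 = 1 := by
    rw [← Real.rpow_natCast ((T - t) ^ (-(3 / 2 : ℝ))) 2, ← Real.rpow_mul hs.le]
    rw [← Real.rpow_natCast (T - t) 3, ← Real.rpow_add hs]
    norm_num
  have h0 : 0 ≤ ‖iteratedFDeriv ℝ 2 (u t) x‖ := norm_nonneg _
  have h2 : ‖iteratedFDeriv ℝ 2 (u t) x‖ ^ 2 ≤ (K₂ * (T - t) ^ (-(3 / 2 : ℝ))) ^ 2 :=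
    pow_le_pow_left₀ h0 h1 2
  calc ‖iteratedFDeriv ℝ 2 (u t) x‖ ^ 2 * (T - t) ^ 3
      ≤ (K₂ * (T - t) ^ (-(3 / 2 : ℝ))) ^ 2 * (T - t) ^ 3 :=
        mul_le_mul_of_nonneg_right h2 (pow_nonneg hs.le 3)
    _ = K₂ ^ 2 * (((T - t) ^ (-(3 / 2 : ℝ))) ^ 2 * (T - t) ^ 3) := by ring
    _ = K₂ ^ 2 := by rw [hsq, mul_one]

/-- **Frequency floor** (companion of `stub_frequencyCeiling`): under the crux hypotheses the
adapted frequency `Λ(t) = (T − t) H′(t)/H(t)` is BOUNDED BELOW on a left neighbourhood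
`[t₁, T)` of `T`; explicitly `Λ ≥ −(2K₁ + 6ν‖curlCLM‖²K₂²/c₀)` with the Type-I derivative
constants `K₁, K₂` and the enstrophy floor `c₀`. -/
theorem frequencyFloor :
    ∀ (ν T : ℝ) (u : ℝ → EuclideanSpace ℝ (Fin 3) → EuclideanSpace ℝ (Fin 3)) (p : ℝ → EuclideanSpace ℝ (Fin 3) → ℝ) (x₀ : EuclideanSpace ℝ (Fin 3)) (t₀ : ℝ) (G : ℝ → EuclideanSpace ℝ (Fin 3) → ℝ), 0 < ν → 0 < T → IsClassicalNSSolutionOn (Ico 0 T) ν 0 u p → IsLerayHopfOn T ν 0 (u 0) u → HasRapidSpatialDecay (u 0) → IsTypeIBlowup u T → t₀ ∈ Ico 0 T → (∀ r : ℝ, 0 < r → eLpNorm (Function.uncurry u) ⊤ (volume.restrict (parabolicCylinder r (T, x₀))) = ⊤) → IsAdaptedBackwardKernel ν u (Ico t₀ T) T x₀ G → IsGaussianComparable G (Ico t₀ T) T x₀ → ∃ t₁ ∈ Ico t₀ T, ∃ m : ℝ, ∀ t ∈ Ico t₁ T, m ≤ adaptedFrequency u G T t := by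
  intro ν T u p x₀ t₀ G hν hT hcl hLH hdec hTI ht₀ hsing hG hcmp
  -- (1) the floor `0 < c₀ ≤ (T − t)² H(t)` on `[t₁, T)`
  obtain ⟨t₁, ht₁, c₀, hc₀, hfloor⟩ :=
    stub_pinchingLower ν T u p x₀ t₀ G hν hT hcl hLH hdec hTI ht₀ hsing hG hcmp
  -- (2) the Type-I gradient and Hessian bounds on `[T/2, T)`
  obtain ⟨K₁, hK₁0, hK₁⟩ := pinchingUpper_fderiv_bound hν hT hcl hLH hdec hTI
  obtain ⟨K₂, hK₂0, hK₂⟩ := frequencyFloor_hessian_sq hν hT hcl hLH hdec hTI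
  -- the dissipation constant
  obtain ⟨κ, hκ⟩ : ∃ κ : ℝ, κ = 3 * ‖curlCLM‖ ^ 2 * K₂ ^ 2 := ⟨_, rfl⟩
  have hκ0 : 0 ≤ κ := by rw [hκ]; positivity
  -- the final window `[t₂, T)`
  obtain ⟨t₂, ht₂def⟩ : ∃ t₂ : ℝ, t₂ = max (max t₁ (T / 2)) ((t₀ + T) / 2) := ⟨_, rfl⟩
  have ht₂T : t₂ < T := by
    rw [ht₂def]; exact max_lt (max_lt ht₁.2 (by linarith)) (by linarith [ht₀.2])
  have h12 : t₁ ≤ t₂ := by rw [ht₂def]; exact (le_max_left _ _).trans (le_max_left _ _)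
  have hH2 : T / 2 ≤ t₂ := by rw [ht₂def]; exact (le_max_right _ _).trans (le_max_left _ _)
  have h02 : (t₀ + T) / 2 ≤ t₂ := by rw [ht₂def]; exact le_max_right _ _
  refine ⟨t₂, ⟨ht₁.1.trans h12, ht₂T⟩, -(2 * K₁ + 2 * ν * κ / c₀), fun t ht => ?_⟩
  have htT : t < T := ht.2
  have hTt : 0 < T - t := sub_pos.2 htT
  have ht1 : t ∈ Ico t₁ T := ⟨h12.trans ht.1, htT⟩
  have htH : t ∈ Ico (T / 2) T := ⟨hH2.trans ht.1, htT⟩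
  have ht0 : t ∈ Ioo t₀ T := ⟨by linarith [ht.1, ht₀.2], htT⟩
  have htS : t ∈ Ico t₀ T := ⟨ht0.1.le, htT⟩
  have ht0T : t ∈ Ico 0 T := ⟨ht₀.1.trans ht0.1.le, htT⟩
  -- `H(t) > 0`, indeed `H(t) ≥ c₀/(T − t)²`
  have hfl := hfloor t ht1
  have hHpos : 0 < adaptedEnstrophy u G t := by
    by_contra hle
    push Not at hle
    have : (T - t) ^ 2 * adaptedEnstrophy u G t ≤ 0 :=
      mul_nonpos_of_nonneg_of_nonpos (sq_nonneg _) hle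
    linarith
  -- the nonnegative constant `2νκ/c₀`
  have hm0 : 0 ≤ 2 * ν * κ / c₀ := by positivity
  -- `H′(t) ≥ −(2K₁/(T − t)) H(t) − 2νκ (T − t)⁻³`
  have hd := (frequencyCeiling_hasDerivAt hν hcl hLH hdec ht₀ hG hcmp ht0).deriv
  have hGi : Integrable (G t) := hG.integrable htS
  have hGp : ∀ x, 0 < G t x := hG.pos t htS
  have hG1 : ∫ x, G t x = 1 := hG.integral_eq_one t htS
  have hu : ContDiff ℝ 2 (u t) := contDiff_infty.1 (hcl.contDiff_velocity ht0T) 2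
  have hu1 : ContDiff ℝ 1 (u t) := contDiff_infty.1 (hcl.contDiff_velocity ht0T) 1
  have hωc : Continuous fun x => ‖curl (u t) x‖ ^ 2 := ((continuous_curl hu1).norm).pow 2
  have hωb : ∀ x, ‖curl (u t) x‖ ^ 2 ≤ (4 * (K₁ / (T - t))) ^ 2 := fun x =>
    pow_le_pow_left₀ (norm_nonneg _)
      ((norm_curl_le_four_mul (u t) x).trans (by gcongr; exact hK₁ t htH x)) 2
  -- integrability of `‖ω‖² G`
  have hωG : Integrable (fun x => ‖curl (u t) x‖ ^ 2 * G t x) := by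
    refine hGi.bdd_mul hωc.aestronglyMeasurable (c := (4 * (K₁ / (T - t))) ^ 2)
      (Eventually.of_forall fun x => ?_)
    rw [Real.norm_eq_abs, abs_of_nonneg (sq_nonneg _)]
    exact hωb x
  -- the dissipation density bound `|∇ω|²_F ≤ κ (T − t)⁻³`
  have hdis : ∀ x, frobeniusNormSq (fderiv ℝ (curl (u t)) x) ≤ κ / (T - t) ^ 3 := by
    intro x
    have h1 := frobeniusNormSq_le_three_mul_sq (fderiv ℝ (curl (u t)) x)
    have h2 : ‖fderiv ℝ (curl (u t)) x‖ ≤ ‖curlCLM‖ * ‖iteratedFDeriv ℝ 2 (u t) x‖ :=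
      norm_fderiv_curl_le hu x
    have h3 : ‖fderiv ℝ (curl (u t)) x‖ ^ 2 ≤ ‖curlCLM‖ ^ 2 * ‖iteratedFDeriv ℝ 2 (u t) x‖ ^ 2 := by
      rw [← mul_pow]; exact pow_le_pow_left₀ (norm_nonneg _) h2 2
    have h4 := hK₂ t htH x
    have hT3 : 0 < (T - t) ^ 3 := pow_pos hTt 3
    rw [le_div_iff₀ hT3, hκ]
    calc frobeniusNormSq (fderiv ℝ (curl (u t)) x) * (T - t) ^ 3
        ≤ 3 * (‖curlCLM‖ ^ 2 * ‖iteratedFDeriv ℝ 2 (u t) x‖ ^ 2) * (T - t) ^ 3 := by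
          gcongr; exact h1.trans (by linarith)
      _ = 3 * ‖curlCLM‖ ^ 2 * (‖iteratedFDeriv ℝ 2 (u t) x‖ ^ 2 * (T - t) ^ 3) := by ring
      _ ≤ 3 * ‖curlCLM‖ ^ 2 * K₂ ^ 2 := by gcongr
  -- the lower integrand `g = −(2K₁/(T−t)) ‖ω‖² G − 2νκ(T−t)⁻³ G`, integrable, `≤ density·G`, `≤ 0`
  have hg : Integrable (fun x => -(2 * (K₁ / (T - t)) * (‖curl (u t) x‖ ^ 2 * G t x)) -
      2 * ν * (κ / (T - t) ^ 3) * G t x) :=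
    ((hωG.const_mul _).neg).sub (hGi.const_mul _)
  have hle : ∀ x, -(2 * (K₁ / (T - t)) * (‖curl (u t) x‖ ^ 2 * G t x)) -
      2 * ν * (κ / (T - t) ^ 3) * G t x ≤
      (2 * ⟪curl (u t) x, fderiv ℝ (u t) x (curl (u t) x)⟫ -
        2 * ν * frobeniusNormSq (fderiv ℝ (curl (u t)) x)) * G t x := fun x => by
    have h1 := frequencyFloor_density_ge ν (curl (u t) x) (fderiv ℝ (u t) x)
      (fderiv ℝ (curl (u t)) x)
    have h2 : 2 * ‖fderiv ℝ (u t) x‖ * ‖curl (u t) x‖ ^ 2 ≤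
        2 * (K₁ / (T - t)) * ‖curl (u t) x‖ ^ 2 := by
      gcongr; exact hK₁ t htH x
    have h3 : 2 * ν * frobeniusNormSq (fderiv ℝ (curl (u t)) x) ≤ 2 * ν * (κ / (T - t) ^ 3) :=
      mul_le_mul_of_nonneg_left (hdis x) (by positivity)
    have h4 : (-(2 * (K₁ / (T - t)) * ‖curl (u t) x‖ ^ 2) - 2 * ν * (κ / (T - t) ^ 3)) * G t x ≤
        (2 * ⟪curl (u t) x, fderiv ℝ (u t) x (curl (u t) x)⟫ -
          2 * ν * frobeniusNormSq (fderiv ℝ (curl (u t)) x)) * G t x :=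
      mul_le_mul_of_nonneg_right (by linarith) (hGp x).le
    calc -(2 * (K₁ / (T - t)) * (‖curl (u t) x‖ ^ 2 * G t x)) - 2 * ν * (κ / (T - t) ^ 3) * G t x
        = (-(2 * (K₁ / (T - t)) * ‖curl (u t) x‖ ^ 2) - 2 * ν * (κ / (T - t) ^ 3)) * G t x := by
          ring
      _ ≤ _ := h4
  have hgnp : ∀ x, -(2 * (K₁ / (T - t)) * (‖curl (u t) x‖ ^ 2 * G t x)) -
      2 * ν * (κ / (T - t) ^ 3) * G t x ≤ 0 := fun x => by
    have h1 : 0 ≤ 2 * (K₁ / (T - t)) * (‖curl (u t) x‖ ^ 2 * G t x) :=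
      mul_nonneg (by positivity) (mul_nonneg (sq_nonneg _) (hGp x).le)
    have h2 : 0 ≤ 2 * ν * (κ / (T - t) ^ 3) * G t x :=
      mul_nonneg (by positivity) (hGp x).le
    linarith
  -- the value of `∫ g`
  have hgint : ∫ x, (-(2 * (K₁ / (T - t)) * (‖curl (u t) x‖ ^ 2 * G t x)) -
      2 * ν * (κ / (T - t) ^ 3) * G t x) =
      -(2 * (K₁ / (T - t)) * adaptedEnstrophy u G t) - 2 * ν * (κ / (T - t) ^ 3) := by
    have hA : Integrable (fun x => -(2 * (K₁ / (T - t)) * (‖curl (u t) x‖ ^ 2 * G t x))) :=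
      (hωG.const_mul _).neg
    have hB : Integrable (fun x => 2 * ν * (κ / (T - t) ^ 3) * G t x) := hGi.const_mul _
    rw [integral_sub hA hB, integral_neg, integral_const_mul, integral_const_mul, hG1, mul_one,
      adaptedEnstrophy_apply]
  have hbound : -(2 * (K₁ / (T - t)) * adaptedEnstrophy u G t) - 2 * ν * (κ / (T - t) ^ 3) ≤
      deriv (adaptedEnstrophy u G) t := by
    rw [hd, ← hgint]
    by_cases hf : Integrable (fun x => (2 * ⟪curl (u t) x, fderiv ℝ (u t) x (curl (u t) x)⟫ -
        2 * ν * frobeniusNormSq (fderiv ℝ (curl (u t)) x)) * G t x)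
    · exact integral_mono hg hf hle
    · rw [integral_undef hf]
      exact integral_nonpos hgnp
  -- conclusion: `Λ(t) = (T − t) H′(t)/H(t) ≥ −2K₁ − 2νκ/c₀`
  rw [adaptedFrequency_apply, le_div_iff₀ hHpos]
  have hkey : (T - t) * (-(2 * (K₁ / (T - t)) * adaptedEnstrophy u G t) -
      2 * ν * (κ / (T - t) ^ 3)) ≤ (T - t) * deriv (adaptedEnstrophy u G) t :=
    mul_le_mul_of_nonneg_left hbound hTt.le
  have hne : T - t ≠ 0 := hTt.ne'
  -- `(T − t) · 2νκ (T − t)⁻³ ≤ (2νκ/c₀) H(t)` from the floor `c₀ ≤ (T − t)² H(t)`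
  have hdiss : (T - t) * (2 * ν * (κ / (T - t) ^ 3)) ≤
      2 * ν * κ / c₀ * adaptedEnstrophy u G t := by
    have hT2 : 0 < (T - t) ^ 2 := pow_pos hTt 2
    have h1 : (T - t) * (2 * ν * (κ / (T - t) ^ 3)) = 2 * ν * κ / (T - t) ^ 2 := by
      field_simp
    rw [h1, div_le_iff₀ hT2]
    calc 2 * ν * κ = 2 * ν * κ / c₀ * c₀ := by field_simp
      _ ≤ 2 * ν * κ / c₀ * ((T - t) ^ 2 * adaptedEnstrophy u G t) :=
          mul_le_mul_of_nonneg_left hfl hm0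
      _ = 2 * ν * κ / c₀ * adaptedEnstrophy u G t * (T - t) ^ 2 := by ring
  have hexp : (T - t) * (-(2 * (K₁ / (T - t)) * adaptedEnstrophy u G t) -
      2 * ν * (κ / (T - t) ^ 3)) =
      -(2 * K₁ * adaptedEnstrophy u G t) - (T - t) * (2 * ν * (κ / (T - t) ^ 3)) := by
    field_simp
  rw [hexp] at hkey
  calc -(2 * K₁ + 2 * ν * κ / c₀) * adaptedEnstrophy u G t
      = -(2 * K₁ * adaptedEnstrophy u G t) - 2 * ν * κ / c₀ * adaptedEnstrophy u G t := by ring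
    _ ≤ -(2 * K₁ * adaptedEnstrophy u G t) - (T - t) * (2 * ν * (κ / (T - t) ^ 3)) := by
        linarith
    _ ≤ (T - t) * deriv (adaptedEnstrophy u G) t := hkey

/-- **The adapted frequency is bounded near `T`**: floor (`frequencyFloor`) and ceiling
(`UnsteadinessSqueeze.stub_frequencyCeiling`) on a common final window. -/
theorem frequency_abs_le :
    ∀ (ν T : ℝ) (u : ℝ → EuclideanSpace ℝ (Fin 3) → EuclideanSpace ℝ (Fin 3)) (p : ℝ → EuclideanSpace ℝ (Fin 3) → ℝ) (x₀ : EuclideanSpace ℝ (Fin 3)) (t₀ : ℝ) (G : ℝ → EuclideanSpace ℝ (Fin 3) → ℝ), 0 < ν → 0 < T → IsClassicalNSSolutionOn (Ico 0 T) ν 0 u p → IsLerayHopfOn T ν 0 (u 0) u → HasRapidSpatialDecay (u 0) → IsTypeIBlowup u T → t₀ ∈ Ico 0 T → (∀ r : ℝ, 0 < r → eLpNorm (Function.uncurry u) ⊤ (volume.restrict (parabolicCylinder r (T, x₀))) = ⊤) → IsAdaptedBackwardKernel ν u (Ico t₀ T) T x₀ G → IsGaussianComparable G (Ico t₀ T)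 T x₀ → ∃ t₁ ∈ Ico t₀ T, ∃ M : ℝ, ∀ t ∈ Ico t₁ T, |adaptedFrequency u G T t| ≤ M := by
  intro ν T u p x₀ t₀ G hν hT hcl hLH hdec hTI ht₀ hsing hG hcmp
  obtain ⟨t₁, ht₁, m, hm⟩ := frequencyFloor ν T u p x₀ t₀ G hν hT hcl hLH hdec hTI ht₀ hsing hG hcmp
  obtain ⟨t₂, ht₂, M, hM⟩ :=
    stub_frequencyCeiling ν T u p x₀ t₀ G hν hT hcl hLH hdec hTI ht₀ hsing hG hcmp
  refine ⟨max t₁ t₂, ⟨le_max_of_le_left ht₁.1, max_lt ht₁.2 ht₂.2⟩, max |m| |M|, fun t ht => ?_⟩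
  have h1 := hm t ⟨(le_max_left _ _).trans ht.1, ht.2⟩
  have h2 := hM t ⟨(le_max_right _ _).trans ht.1, ht.2⟩
  rw [abs_le]
  constructor
  · have : -max |m| |M| ≤ m := by
      have := neg_abs_le m
      have := le_max_left |m| |M|
      linarith
    linarith
  · exact h2.trans ((le_abs_self M).trans (le_max_right _ _))

end Summit.NavierStokesRegularity.NavierStokesRegularity.Theorems.AdaptedFrequencyConverges.LimitTwo

end
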